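import Summits.BirchSwinnertonDyer.BirchSwinnertonDyer.Theorems.Rank2Observatory428298m1TwoDescZ2Tables
import Summits.BirchSwinnertonDyer.BirchSwinnertonDyer.Theorems.Rank2Observatory2DescZ2OddCaseParity
import Summits.BirchSwinnertonDyer.BirchSwinnertonDyer.Theorems.Rank2Observatory2DescZ2RankBound
import Summits.BirchSwinnertonDyer.BirchSwinnertonDyer.Theorems.Rank2Observatory2DescZ2Sign
import Summits.BirchSwinnertonDyer.BirchSwinnertonDyer.Theorems.Rank2ObservatoryKernelWalk85b2
import Mathlib.AlgebraicGeometry.EllipticCurve.VariableChange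
import HarnessLib

/-!
# BirchSwinnertonDyer — rank ≥ 2 observatory: `rank E(ℚ) = 2` for `428298m1` by the `μ_θ` descent over `ℚ(√17)` (third ℤ/2-torsion row)

HONEST FRAMING: per-curve certified theorems and census instruments; no claim on BSD in rank ≥ 2.

Third row of the successor instrument KERNEL-2DESC-Z2 (`code/b2b-bsdr2-cert-3/kernel-2desc-z2/README-Z2.md`), the first over
`ℚ(√17)`, rank half: the `2`-adic class tables, the necessary sets, the admissibility count and the rank theorems; the curve,
the support of `F′(θ)` and the odd-place class tables are in `…428298m1TwoDescZ2Tables`, the field-level data in `…QuadField17RowKit`.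
The census curve `428298m1 = [1,1,0,-21415050,-5201397504]` has a rational `2`-torsion point; the variable change
`(u,r,s,t) = (1/2, 4744, -1/2, -2372)` carries it to `E_{56933,737814688} : y² = x³ + 56933x² + 737814688x`, whose other
`2`-division field is `K = ℚ(θ)`, `θ² + 56933θ + 737814688 = 0`, `θ = -30532 + 4131ω`, `ω² = ω + 4` (`K = ℚ(√17)`,
with class number one, fundamental unit `ε = -3 - 2ω` of norm `-1`). The `μ_θ` cover
(`…Z2RankBound.mordellWeilRank_le_of_coverSet_z2`) is run with the unit family `(-1, ε)`, the support
`G = (π₂, 3, π₁₃, √17, π₁₉)` of `F′(θ) = θ(2θ + 56933) = -ε⁻⁴ · π₂^5 · 3^5 · π₁₃ · (√17)^6 · π₁₉²` and the sieve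
`adm` = sign at the real place `ω ↦ (1 - √17)/2` ∧ refined odd clauses WITH the unit-parity constraint at the split places `13`, `19`
(`…Z2OddCaseParity.oddClauseRP_sound`, places `…QuadField17Places`) ∧ the `2`-adic clause
(`…Z2RowKit.twoClause_sound`): `12 < 16` admissible pairs, so `rank ≤ 2`; the lower bound is the tree's
kernel-walk certificate (`…KernelWalk85b2`). Every containment is a `decide`; signs use only the rational
bounds `-2 < ρ(ω) < -3/2`. Sorry-free; standard axioms only
(`propext`, `Classical.choice`, `Quot.sound`; the counts are `decide` / `decide +kernel`, no `native_decide`).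
[cite: Cassels1991LecturesEllipticCurves, §15] [cite: CremonaAlgorithms1997, §3.6 (Cremona label `428298m1`)]
-/

-- single-conjunct summit: `Summit.BirchSwinnertonDyer.BirchSwinnertonDyer.…` repeats the name by design
set_option linter.dupNamespace false

noncomputable section

open scoped NumberField

open Polynomial Module NumberField

namespace Summit.BirchSwinnertonDyer.BirchSwinnertonDyer.Rank2Observatory.TwoDescZ2

namespace C428298m1

open QuadField17

/-! ## The `2`-adic class tables of the generators and of `-θ` (certificates `α = π^k β`, `β mod 8` odd) -/

/-- Classes `(k mod 2, β mod 8 bits)` of the five generators at `P24`. -/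
def bg24 : Fin 5 → ZMod 2 × ZMod 2 × ZMod 2 := ![((1 : ZMod 2), (0 : ZMod 2), (0 : ZMod 2)), ((0 : ZMod 2), (1 : ZMod 2), (0 : ZMod 2)), ((0 : ZMod 2), (0 : ZMod 2), (0 : ZMod 2)), ((0 : ZMod 2), (1 : ZMod 2), (1 : ZMod 2)), ((0 : ZMod 2), (0 : ZMod 2), (1 : ZMod 2))]
/-- Classes `(k mod 2, β mod 8 bits)` of the five generators at `P25`. -/
def bg25 : Fin 5 → ZMod 2 × ZMod 2 × ZMod 2 := ![((0 : ZMod 2), (1 : ZMod 2), (1 : ZMod 2)), ((0 : ZMod 2), (1 : ZMod 2), (0 : ZMod 2)), ((0 : ZMod 2), (1 : ZMod 2), (0 : ZMod 2)), ((0 : ZMod 2), (0 : ZMod 2), (0 : ZMod 2)), ((0 : ZMod 2), (1 : ZMod 2), (1 : ZMod 2))]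

/-- The generator class table at `P24` is correct (one `bitsAt₂_eq` certificate per generator). [folklore] -/
theorem hbg24 : ∀ j, bitsAt₂ P24 ((![g2a, three, g13a, r17, g19a] : Fin 5 → 𝓞 (QuadField (-1) (-4))) j) = bg24 j := by
  intro j
  fin_cases j
  · show bitsAt₂ P24 g2a = ((1 : ZMod 2), (0 : ZMod 2), (0 : ZMod 2))
    rw [g2a]
    rw [bitsAt₂_eq (d := P24) (k := 1) (β := MonicQuad.lin aeval_ω 1 0)
      (by rw [show P24.π = g2a from rfl, g2a]; simp only [MonicQuad.lin]; push_cast; linear_combination (0) * ωi_rel)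
      (by rw [P24_res_lin]; decide), P24_res_lin]; decide
  · show bitsAt₂ P24 three = ((0 : ZMod 2), (1 : ZMod 2), (0 : ZMod 2))
    rw [three]
    rw [bitsAt₂_eq (d := P24) (k := 0) (β := MonicQuad.lin aeval_ω 3 0) (by rw [pow_zero, one_mul]) (by rw [P24_res_lin]; decide),
      P24_res_lin]; decide
  · show bitsAt₂ P24 g13a = ((0 : ZMod 2), (0 : ZMod 2), (0 : ZMod 2))
    rw [g13a]
    rw [bitsAt₂_eq (d := P24) (k := 0) (β := MonicQuad.lin aeval_ω 1 2) (by rw [pow_zero, one_mul]) (by rw [P24_res_lin]; decide),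
      P24_res_lin]; decide
  · show bitsAt₂ P24 r17 = ((0 : ZMod 2), (1 : ZMod 2), (1 : ZMod 2))
    rw [r17]
    rw [bitsAt₂_eq (d := P24) (k := 0) (β := MonicQuad.lin aeval_ω (-1) 2) (by rw [pow_zero, one_mul]) (by rw [P24_res_lin]; decide),
      P24_res_lin]; decide
  · show bitsAt₂ P24 g19a = ((0 : ZMod 2), (0 : ZMod 2), (1 : ZMod 2))
    rw [g19a]
    rw [bitsAt₂_eq (d := P24) (k := 0) (β := MonicQuad.lin aeval_ω 5 2) (by rw [pow_zero, one_mul]) (by rw [P24_res_lin]; decide),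
      P24_res_lin]; decide
/-- The class of `-θ` at `P24`. [folklore] -/
theorem hnθ24 : bitsAt₂ P24 (-(MonicQuad.lin aeval_ω (-30532) 4131 : 𝓞 (QuadField (-1) (-4)))) = ((1 : ZMod 2), (1 : ZMod 2), (1 : ZMod 2)) := by
  rw [bitsAt₂_eq (d := P24) (k := 5) (β := MonicQuad.lin aeval_ω 1418055 (-553588))
    (by rw [show P24.π = g2a from rfl, g2a]; simp only [MonicQuad.lin]; push_cast; linear_combination (11336807 + 21099227 * (MonicQuad.thetaInt aeval_ω) + 14848735 * (MonicQuad.thetaInt aeval_ω) ^ 2 + 4671413 * (MonicQuad.thetaInt aeval_ω) ^ 3 + 553588 * (MonicQuad.thetaInt aeval_ω) ^ 4) * ωi_rel)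
    (by rw [P24_res_lin]; decide), P24_res_lin]; decide

/-- The generator class table at `P25` is correct (one `bitsAt₂_eq` certificate per generator). [folklore] -/
theorem hbg25 : ∀ j, bitsAt₂ P25 ((![g2a, three, g13a, r17, g19a] : Fin 5 → 𝓞 (QuadField (-1) (-4))) j) = bg25 j := by
  intro j
  fin_cases j
  · show bitsAt₂ P25 g2a = ((0 : ZMod 2), (1 : ZMod 2), (1 : ZMod 2))
    rw [g2a]
    rw [bitsAt₂_eq (d := P25) (k := 0) (β := MonicQuad.lin aeval_ω 2 1) (by rw [pow_zero, one_mul]) (by rw [P25_res_lin]; decide),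
      P25_res_lin]; decide
  · show bitsAt₂ P25 three = ((0 : ZMod 2), (1 : ZMod 2), (0 : ZMod 2))
    rw [three]
    rw [bitsAt₂_eq (d := P25) (k := 0) (β := MonicQuad.lin aeval_ω 3 0) (by rw [pow_zero, one_mul]) (by rw [P25_res_lin]; decide),
      P25_res_lin]; decide
  · show bitsAt₂ P25 g13a = ((0 : ZMod 2), (1 : ZMod 2), (0 : ZMod 2))
    rw [g13a]
    rw [bitsAt₂_eq (d := P25) (k := 0) (β := MonicQuad.lin aeval_ω 1 2) (by rw [pow_zero, one_mul]) (by rw [P25_res_lin]; decide),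
      P25_res_lin]; decide
  · show bitsAt₂ P25 r17 = ((0 : ZMod 2), (0 : ZMod 2), (0 : ZMod 2))
    rw [r17]
    rw [bitsAt₂_eq (d := P25) (k := 0) (β := MonicQuad.lin aeval_ω (-1) 2) (by rw [pow_zero, one_mul]) (by rw [P25_res_lin]; decide),
      P25_res_lin]; decide
  · show bitsAt₂ P25 g19a = ((0 : ZMod 2), (1 : ZMod 2), (1 : ZMod 2))
    rw [g19a]
    rw [bitsAt₂_eq (d := P25) (k := 0) (β := MonicQuad.lin aeval_ω 5 2) (by rw [pow_zero, one_mul]) (by rw [P25_res_lin]; decide),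
      P25_res_lin]; decide
/-- The class of `-θ` at `P25`. [folklore] -/
theorem hnθ25 : bitsAt₂ P25 (-(MonicQuad.lin aeval_ω (-30532) 4131 : 𝓞 (QuadField (-1) (-4)))) = ((0 : ZMod 2), (0 : ZMod 2), (1 : ZMod 2)) := by
  rw [bitsAt₂_eq (d := P25) (k := 0) (β := -(MonicQuad.lin aeval_ω (-30532) 4131 : 𝓞 (QuadField (-1) (-4)))) (by rw [pow_zero, one_mul]) (by rw [map_neg, P25_res_lin]; decide),
    map_neg, P25_res_lin]; decide

/-! ## The necessary sets and the admissibility test -/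

/-- Refined necessary set with unit parity at `13` (4 pairs). -/
def N13 : Finset ((ZMod 2 × ZMod 2) × (ZMod 2 × ZMod 2)) := {(((0 : ZMod 2), (0 : ZMod 2)), ((0 : ZMod 2), (0 : ZMod 2))), (((0 : ZMod 2), (1 : ZMod 2)), ((0 : ZMod 2), (0 : ZMod 2))), (((1 : ZMod 2), (0 : ZMod 2)), ((0 : ZMod 2), (1 : ZMod 2))), (((1 : ZMod 2), (1 : ZMod 2)), ((0 : ZMod 2), (1 : ZMod 2)))}
/-- Refined necessary set with unit parity at `19` (4 pairs). -/
def N19 : Finset ((ZMod 2 × ZMod 2) × (ZMod 2 × ZMod 2)) := {(((0 : ZMod 2), (0 : ZMod 2)), ((0 : ZMod 2), (0 : ZMod 2))), (((0 : ZMod 2), (1 : ZMod 2)), ((0 : ZMod 2), (0 : ZMod 2))), (((1 : ZMod 2), (0 : ZMod 2)), ((0 : ZMod 2), (0 : ZMod 2))), (((1 : ZMod 2), (1 : ZMod 2)), ((0 : ZMod 2), (0 : ZMod 2)))}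
/-- Necessary set at `2` (20 pairs, coarse casework). -/
def N2 : Finset ((ZMod 2 × ZMod 2 × ZMod 2) × (ZMod 2 × ZMod 2 × ZMod 2)) := {(((0 : ZMod 2), (0 : ZMod 2), (0 : ZMod 2)), ((0 : ZMod 2), (0 : ZMod 2), (0 : ZMod 2))), (((0 : ZMod 2), (0 : ZMod 2), (0 : ZMod 2)), ((0 : ZMod 2), (0 : ZMod 2), (1 : ZMod 2))), (((0 : ZMod 2), (0 : ZMod 2), (1 : ZMod 2)), ((0 : ZMod 2), (0 : ZMod 2), (0 : ZMod 2))), (((0 : ZMod 2), (0 : ZMod 2), (1 : ZMod 2)), ((0 : ZMod 2), (0 : ZMod 2), (1 : ZMod 2))), (((0 : ZMod 2), (1 : ZMod 2), (0 : ZMod 2)), ((0 : ZMod 2), (0 : ZMod 2), (0 : ZMod 2))), (((0 : ZMod 2), (1 : ZMod 2), (0 : ZMod 2)), ((0 : ZMod 2), (0 : ZMod 2), (1 : ZMod 2))), (((0 : ZMod 2), (1 : ZMod 2), (0 : ZMod 2)), ((0 : ZMod 2), (1 : ZMod 2), (0 : ZMod 2))), (((0 : ZMod 2), (1 : ZMod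 2), (0 : ZMod 2)), ((0 : ZMod 2), (1 : ZMod 2), (1 : ZMod 2))), (((0 : ZMod 2), (1 : ZMod 2), (1 : ZMod 2)), ((0 : ZMod 2), (0 : ZMod 2), (0 : ZMod 2))), (((0 : ZMod 2), (1 : ZMod 2), (1 : ZMod 2)), ((0 : ZMod 2), (0 : ZMod 2), (1 : ZMod 2))), (((0 : ZMod 2), (1 : ZMod 2), (1 : ZMod 2)), ((0 : ZMod 2), (1 : ZMod 2), (0 : ZMod 2))), (((0 : ZMod 2), (1 : ZMod 2), (1 : ZMod 2)), ((0 : ZMod 2), (1 : ZMod 2), (1 : ZMod 2))), (((1 : ZMod 2), (0 : ZMod 2), (0 : ZMod 2)), ((0 : ZMod 2), (0 : ZMod 2), (1 : ZMod 2))), (((1 : ZMod 2), (0 : ZMod 2), (0 : ZMod 2)), ((0 : ZMod 2), (1 : ZMod 2), (1 : ZMod 2))), (((1 : ZMod 2), (0 : ZMod 2), (1 : ZMod 2)), ((0 : ZMod 2), (0 : ZMod 2), (1 : ZMod 2))), (((1 : ZMod 2), (0 : ZMod 2), (1 : ZMod 2)), ((0 : ZMod 2), (1 : ZMod 2), (1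 : ZMod 2))), (((1 : ZMod 2), (1 : ZMod 2), (0 : ZMod 2)), ((0 : ZMod 2), (0 : ZMod 2), (1 : ZMod 2))), (((1 : ZMod 2), (1 : ZMod 2), (0 : ZMod 2)), ((0 : ZMod 2), (1 : ZMod 2), (0 : ZMod 2))), (((1 : ZMod 2), (1 : ZMod 2), (1 : ZMod 2)), ((0 : ZMod 2), (0 : ZMod 2), (1 : ZMod 2))), (((1 : ZMod 2), (1 : ZMod 2), (1 : ZMod 2)), ((0 : ZMod 2), (1 : ZMod 2), (0 : ZMod 2)))}

/-- Sign bits of the units `(-1, ε)` at the real place `ω ↦ (1 - √17)/2` (`true` = negative). -/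
def su : Fin 2 → Bool := ![true, false]
/-- Sign bits of the five generators at the real place `ω ↦ (1 - √17)/2` (`true` = negative). -/
def sg : Fin 5 → Bool := ![false, false, true, true, false]

/-- The admissibility test: sign ∧ place `13` ∧ place `19` ∧ place `2`. -/
def adm (T : Finset (Fin 2)) (U : Finset (Fin 5)) : Bool :=
  ((admSign su sg T U &&
    decide ((∑ i ∈ T, bu13a i + ∑ j ∈ U, bg13a j, ∑ i ∈ T, bu13b i + ∑ j ∈ U, bg13b j) ∈ N13)) &&
    decide ((∑ i ∈ T, bu19a i + ∑ j ∈ U, bg19a j, ∑ i ∈ T, bu19b i + ∑ j ∈ U, bg19b j) ∈ N19)) &&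
    decide ((∑ i ∈ T, bu24 i + ∑ j ∈ U, bg24 j, ∑ i ∈ T, bu25 i + ∑ j ∈ U, bg25 j) ∈ N2)

/-! ## The rank -/

set_option maxHeartbeats 4000000 in
set_option synthInstance.maxSize 8192 in
set_option synthInstance.maxHeartbeats 400000 in
/-- **`rank E_{56933,737814688}(ℚ) ≤ 2`** by the `μ_θ` cover with 12 admissible pairs (`< 16`).
[cite: Cassels1991LecturesEllipticCurves, §15] -/
theorem mordellWeilRank_le_two : haveI := isElliptic; ((⟨0, 56933, 0, 737814688, 0⟩ : WeierstrassCurve ℚ)).mordellWeilRank ≤ 2 := by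
  haveI := isElliptic
  obtain ⟨ρ, hρ1, hρ2⟩ := exists_rho_bounds
  set θK : QuadField (-1) (-4) := algebraMap (𝓞 (QuadField (-1) (-4))) (QuadField (-1) (-4)) (MonicQuad.lin aeval_ω (-30532) 4131 : 𝓞 (QuadField (-1) (-4))) with hθKdef
  have hθK : θK ^ 2 + algebraMap ℚ (QuadField (-1) (-4)) ((56933 : ℤ) : ℚ) * θK + algebraMap ℚ (QuadField (-1) (-4)) ((737814688 : ℤ) : ℚ) = 0 := by
    have h := congrArg (algebraMap (𝓞 (QuadField (-1) (-4))) (QuadField (-1) (-4))) hq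
    simp only [map_add, map_mul, map_pow, map_intCast, _root_.map_zero] at h
    simpa only [map_intCast] using h
  have hθQ : ∀ q : ℚ, algebraMap ℚ (QuadField (-1) (-4)) q ≠ θK :=
    theta_not_rat hθK (not_isSquare_rat_of_zmod 5 (by decide))
  have hρθ : ρ θK = -30532 + 4131 * ρ (QuadField.root (-1) (-4)) := by
    rw [hθKdef, rho_lin]; push_cast; ring
  have hneg : ρ θK < 0 := by rw [hρθ]; linarith
  have hsm : 2 * ρ θK + ((56933 : ℤ) : ℝ) < 0 := by rw [hρθ]; push_cast; linarith
  have hinj : Function.Injective (algebraMap (𝓞 (QuadField (-1) (-4))) (QuadField (-1) (-4))) := IsFractionRing.injective (𝓞 (QuadField (-1) (-4))) (QuadField (-1) (-4))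
  have hw0 : ∀ i, algebraMap (𝓞 (QuadField (-1) (-4))) (QuadField (-1) (-4)) ((units i : (𝓞 (QuadField (-1) (-4)))ˣ) : 𝓞 (QuadField (-1) (-4))) ≠ 0 :=
    fun i => (map_ne_zero_iff _ hinj).mpr (units i).ne_zero
  have hg0' : ∀ j, algebraMap (𝓞 (QuadField (-1) (-4))) (QuadField (-1) (-4)) ((![g2a, three, g13a, r17, g19a] : Fin 5 → 𝓞 (QuadField (-1) (-4))) j) ≠ 0 :=
    fun j => (map_ne_zero_iff _ hinj).mpr (G_prime j).ne_zero
  have hsu : ∀ i, su i = true ↔ ρ (algebraMap (𝓞 (QuadField (-1) (-4))) (QuadField (-1) (-4)) ((units i : (𝓞 (QuadField (-1) (-4)))ˣ) : 𝓞 (QuadField (-1) (-4)))) < 0 := by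
    intro i
    fin_cases i
    · show true = true ↔ ρ (algebraMap (𝓞 (QuadField (-1) (-4))) (QuadField (-1) (-4)) (MonicQuad.lin aeval_ω (-1) 0)) < 0
      rw [rho_lin]; push_cast; exact iff_of_true rfl (by linarith)
    · show false = true ↔ ρ (algebraMap (𝓞 (QuadField (-1) (-4))) (QuadField (-1) (-4)) (MonicQuad.lin aeval_ω (-3) (-2))) < 0
      rw [rho_lin]; push_cast; exact iff_of_false (by decide) (not_lt.mpr (by linarith))
  have hsg : ∀ j, sg j = true ↔ ρ (algebraMap (𝓞 (QuadField (-1) (-4))) (QuadField (-1) (-4)) ((![g2a, three, g13a, r17, g19a] : Fin 5 → 𝓞 (QuadField (-1) (-4))) j)) < 0 := by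
    intro j
    fin_cases j
    · show false = true ↔ ρ (algebraMap (𝓞 (QuadField (-1) (-4))) (QuadField (-1) (-4)) g2a) < 0
      refine iff_of_false (by decide) (not_lt.mpr ?_)
      rw [g2a, rho_lin]; push_cast; linarith
    · show false = true ↔ ρ (algebraMap (𝓞 (QuadField (-1) (-4))) (QuadField (-1) (-4)) three) < 0
      refine iff_of_false (by decide) (not_lt.mpr ?_)
      rw [three, rho_lin]; push_cast; linarith
    · show true = true ↔ ρ (algebraMap (𝓞 (QuadField (-1) (-4))) (QuadField (-1) (-4)) g13a) < 0
      refine iff_of_true rfl ?_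
      rw [g13a, rho_lin]; push_cast; linarith
    · show true = true ↔ ρ (algebraMap (𝓞 (QuadField (-1) (-4))) (QuadField (-1) (-4)) r17) < 0
      refine iff_of_true rfl ?_
      rw [r17, rho_lin]; push_cast; linarith
    · show false = true ↔ ρ (algebraMap (𝓞 (QuadField (-1) (-4))) (QuadField (-1) (-4)) g19a) < 0
      refine iff_of_false (by decide) (not_lt.mpr ?_)
      rw [g19a, rho_lin]; push_cast; linarith
  -- residues of `θ` and the local side conditions
  have ht13a : P13a.res (MonicQuad.lin aeval_ω (-30532) 4131 : 𝓞 (QuadField (-1) (-4))) = 0 := by rw [P13a_res_lin]; decide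
  have ht13b : P13b.res (MonicQuad.lin aeval_ω (-30532) 4131 : 𝓞 (QuadField (-1) (-4))) = 7 := by rw [P13b_res_lin]; decide
  have ht19a : P19a.res (MonicQuad.lin aeval_ω (-30532) 4131 : 𝓞 (QuadField (-1) (-4))) = 0 := by rw [P19a_res_lin]; decide
  have ht19b : P19b.res (MonicQuad.lin aeval_ω (-30532) 4131 : 𝓞 (QuadField (-1) (-4))) = 10 := by rw [P19b_res_lin]; decide
  have ht24 : P24.res (MonicQuad.lin aeval_ω (-30532) 4131 : 𝓞 (QuadField (-1) (-4))) = 0 := by rw [P24_res_lin]; decide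
  have ht25 : P25.res (MonicQuad.lin aeval_ω (-30532) 4131 : 𝓞 (QuadField (-1) (-4))) = 3 := by rw [P25_res_lin]; decide
  have hG0 : ∀ j, ((![g2a, three, g13a, r17, g19a] : Fin 5 → 𝓞 (QuadField (-1) (-4))) j) ≠ 0 := fun j => (G_prime j).ne_zero
  have hadm : ∀ x y : ℚ, y ^ 2 = x ^ 3 + ((56933 : ℤ) : ℚ) * x ^ 2 + ((737814688 : ℤ) : ℚ) * x →
      ∀ (T : Finset (Fin 2)) (U : Finset (Fin 5)),
        IsSquare ((algebraMap ℚ (QuadField (-1) (-4)) x - algebraMap (𝓞 (QuadField (-1) (-4))) (QuadField (-1) (-4)) (MonicQuad.lin aeval_ω (-30532) 4131 : 𝓞 (QuadField (-1) (-4)))) *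
          (∏ i ∈ T, algebraMap (𝓞 (QuadField (-1) (-4))) (QuadField (-1) (-4)) ((units i : (𝓞 (QuadField (-1) (-4)))ˣ) : 𝓞 (QuadField (-1) (-4)))) * ∏ j ∈ U, algebraMap (𝓞 (QuadField (-1) (-4))) (QuadField (-1) (-4)) ((![g2a, three, g13a, r17, g19a] : Fin 5 → 𝓞 (QuadField (-1) (-4))) j)) →
        adm T U = true := by
    intro x y hE
    refine adm_and_sound (adm_and_sound (adm_and_sound ?_ ?_) ?_) ?_
    · intro T U hsq
      exact admSign_sound ρ hθK hθQ hneg hsm hw0 hg0' hsu hsg x y hE T U hsq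
    · intro T U hsq
      rw [decide_eq_true_eq]
      exact oddClauseRP_sound P13a P13b hq theta_ne_zero hθQ ht13a ht13b (by decide) (by decide) P13a_c P13b_c
        hθp13a hβ13a hθp13b hβ13b hnθ13a hnθ13b hG0 hbu13a hbu13b hbg13a hbg13b N13 (by decide) (by decide) (by decide)
        (by decide) hE T U hsq
    · intro T U hsq
      rw [decide_eq_true_eq]
      exact oddClauseRP_sound P19a P19b hq theta_ne_zero hθQ ht19a ht19b (by decide) (by decide) P19a_c P19b_c
        hθp19a hβ19a hθp19b hβ19b hnθ19a hnθ19b hG0 hbu19a hbu19b hbg19a hbg19b N19 (by decide) (by decide) (by decide)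
        (by decide) hE T U hsq
    · intro T U hsq
      rw [decide_eq_true_eq]
      exact twoClause_sound P24 P25 hq theta_ne_zero hθQ (by decide) ht24 ht25 P24_rho P25_rho hG0
        hbu24 hbu25 hbg24 hbg25 N2 (by decide) (by decide) (by rw [hnθ24, hnθ25]; decide) hE T U hsq
  exact mordellWeilRank_le_of_coverSet_z2 (A := 56933) (B := 737814688) (⟨0, 56933, 0, 737814688, 0⟩ : WeierstrassCurve ℚ)
    rfl (by norm_num) rfl (by norm_num) rfl hq (linIndep_quad hθQ) (span_quad finrank_eq hθQ)
    (not_isSquare_rat_of_zmod 5 (by decide)) G_injective hG0 support_deriv units_span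
    (by decide) hadm (by decide +kernel)

/-- **`2 ≤ rank E(ℚ)` for `428298m1`**, read off the walker kernel certificate list `kernelCertRowsW85b2`.
[cite: CremonaAlgorithms1997, §3.6 (Cremona label `428298m1`)] -/
theorem two_le_rank : 2 ≤ ((⟨1, 1, 0, -21415050, -5201397504⟩ : WeierstrassCurve ℤ).map (Int.castRingHom ℚ)).mordellWeilRank := by
  have h := two_le_mordellWeilRank_of_mem_kernelCertRowsW85b2 ⟨"428298m1", 1, 1, 0, -21415050, -5201397504, 428298, (-1431, 150768, 1), (40122, 7962732, 1)⟩ (by decide +kernel)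
  have hc : Rank2Row.curve ⟨"428298m1", 1, 1, 0, -21415050, -5201397504, 428298, (-1431, 150768, 1), (40122, 7962732, 1)⟩ = (⟨1, 1, 0, -21415050, -5201397504⟩ : WeierstrassCurve ℤ).map (Int.castRingHom ℚ) := by
    ext <;> simp [Rank2Row.curve, WeierstrassCurve.map]
  rwa [hc] at h

/-- **`rank E(ℚ) = 2` for `428298m1`** (upper bound: the `μ_θ` cover on the model `E_{56933,737814688}`, reached by
`(u,r,s,t) = (1/2, 4744, -1/2, -2372)`; lower bound: the tree certificate). [cite: CremonaAlgorithms1997, §3.6 (Cremona label `428298m1`)] -/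
theorem mordellWeilRank_eq_two :
    ((⟨1, 1, 0, -21415050, -5201397504⟩ : WeierstrassCurve ℤ).map (Int.castRingHom ℚ)).mordellWeilRank = 2 := by
  have hV : (⟨0, 56933, 0, 737814688, 0⟩ : WeierstrassCurve ℚ) =
      (⟨Units.mk0 (1 / 2 : ℚ) (by norm_num), 4744, -(1 : ℚ) / 2, -2372⟩ :
        WeierstrassCurve.VariableChange ℚ) • ((⟨1, 1, 0, -21415050, -5201397504⟩ : WeierstrassCurve ℤ).map (Int.castRingHom ℚ)) := by
    ext <;> simp only [WeierstrassCurve.map_a₁, WeierstrassCurve.map_a₂, WeierstrassCurve.map_a₃,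
      WeierstrassCurve.map_a₄, WeierstrassCurve.map_a₆, WeierstrassCurve.variableChange_a₁,
      WeierstrassCurve.variableChange_a₂, WeierstrassCurve.variableChange_a₃,
      WeierstrassCurve.variableChange_a₄, WeierstrassCurve.variableChange_a₆, Units.val_inv_eq_inv_val,
      Units.val_mk0] <;> norm_num
  have hr : ((⟨0, 56933, 0, 737814688, 0⟩ : WeierstrassCurve ℚ)).mordellWeilRank =
      ((⟨1, 1, 0, -21415050, -5201397504⟩ : WeierstrassCurve ℤ).map (Int.castRingHom ℚ)).mordellWeilRank := by
    rw [hV]; exact WeierstrassCurve.mordellWeilRank_variableChange_holds _ _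
  refine le_antisymm ?_ two_le_rank
  rw [← hr]
  exact mordellWeilRank_le_two

end C428298m1

end Summit.BirchSwinnertonDyer.BirchSwinnertonDyer.Rank2Observatory.TwoDescZ2

end
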